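import Summits.CriticalPhenomena.PercolationContinuityZ3.Theses.PercNonProliferation
import Summits.CriticalPhenomena.PercolationContinuityZ3.Theorems.FreeBoxSparse.Negative.OfContinuity
import Literature.Probability.Percolation.AnchoredProfileVanishing
import Literature.Probability.Percolation.UniquenessZone
import Literature.Probability.Percolation.BoxGatewayRarity

/-!
# STRATEGY CENSUS — typed companion (crux-strategist wall-breaker, crux stmt-CriticalPhenomena-4445
# `PercNonProliferation.FreeBoxSparse`, 2026-08-17)

Props only (plus two one-line sanity theorems). Every statement named in
`Cruxes/FreeBoxSparse/STRATEGY-CENSUS.md` under the headings Transfer / Strengthen / Decomposition /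
Negation is typed here over existing declarations, so that the census can be audited signature by
signature. Nothing here is a stub of a line: the census explains, per statement, why it gives no
leverage (summit-strength, ≡ crux modulo landed lemmas, false in the healthy world, or vacuous).

Notation: `Λ_n = box 3 n`, `P = P_{p_c}` on `ℤ³` (bond), `FA₂(n)` the crux's pair average,
`h t := P(halfSpaceReach 3 t)` the boundary-rooted half-space one-arm to depth `t` (BGN: `h t → 0`).
-/

noncomputable section

open MeasureTheory Filter Topology
open scoped Classical
open Literature.Probability.Percolation Literature.Probability.LatticeModels
open Literature.Probability.Percolation.CerfDembinVanishing (halfSpaceReach tendsto_measure_halfSpaceReach)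
open Summit.CriticalPhenomena.PercolationContinuityZ3.Theses.PercNonProliferation (FreeBoxSparse
  NonProliferation SubpolynomialBlocking FreeBoxPowerSaving)

namespace Summit.CriticalPhenomena.PercolationContinuityZ3.Cruxes.FreeBoxSparse.StrategyCensus

/-! ## §0 Vocabulary -/

abbrev V3 : Type := Site 3
abbrev μc : Measure (BondConfig V3) := bondPercolation (zdGraph 3) (criticalProbI 3)

/-- The crux's quantity `FA₂(p_c, n)`. -/
def fa2 (n : ℕ) : ℝ :=
  (∑ x ∈ box 3 n, ∑ y ∈ box 3 n, μc.real (openConnIn ↑(box 3 n) x y)) / ((box 3 n).card : ℝ) ^ 2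

/-- The crux, restated definitionally. -/
theorem freeBoxSparse_iff : FreeBoxSparse ↔ Tendsto fa2 atTop (𝓝 0) := Iff.rfl

/-- Boundary-rooted half-space one-arm to depth `t` at `p_c(ℤ³)`: `h t = P_{p_c}(0 ↔ height ≥ t in ℍ)`. -/
def h (t : ℕ) : ℝ := μc.real (halfSpaceReach 3 t)

/-- Size of the free piece of `x` in `Λ`. -/
def pieceCard (Λ : Finset V3) (ω : BondConfig V3) (x : V3) : ℕ :=
  (Λ.filter fun v => ω ∈ openConnIn (↑Λ : Set V3) x v).card

/-- `x`'s free piece is `δ`-dense in `Λ`. -/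
def IsDense (δ : ℝ) (Λ : Finset V3) (ω : BondConfig V3) (x : V3) : Prop :=
  δ * (Λ.card : ℝ) ≤ (pieceCard Λ ω x : ℝ)

/-! ## §T Transfer — the solved siblings' version of THIS step, typed where it is a statement on ℤ³ -/

/-- T2 (3D Ising / ADS 2015 transfer input): a pointwise **infrared bound** for critical
connectivity, `τ_{p_c}(0,x) ≤ C / ‖x‖_∞` (the `|x|^{2-d}` Gaussian-domination shape in `d = 3`).
It would give the crux in two lines (Cesàro); it is NOT available for `q = 1` (no reflection
positivity for connectivities) and is numerically FALSE on `ℤ³` (η = −0.046 < 0: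
`τ ≍ |x|^{-0.954} ≫ |x|^{-1}`). Census §Transfer T2. -/
def InfraredBoundPerc : Prop :=
  ∃ C : ℝ, ∀ x : V3, x ≠ 0 → tau 3 (criticalProbI 3) 0 x ≤ C / (((box 3 0).card : ℝ) + ⨆ i, |(x i : ℝ)|)

/-- T1 (planar transfer input, the 3D "RSW"): annulus blocking with probability bounded below
(`= PercAnnulusCrossing.CritAnnulusNonCrossing`, stmt-0846, BCKS postulate). Summit-strength:
it implies `θ(p_c) = 0` directly (one-arm multiplicativity), and FBS by the quarantine sandwich
(card blocking-quarantine-wiring W1). Census §Transfer T1. -/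
def AnnulusBlockingFloor : Prop :=
  ∃ c : ℝ, 0 < c ∧ ∀ n : ℕ, 1 ≤ n → c ≤ μc.real {ω | ¬ ∃ x ∈ box 3 n,
    ∃ y ∈ innerBoundary (zdGraph 3) (box 3 (2 * n)), ω ∈ openConnIn ↑(box 3 (2 * n)) x y}

/-! ## §S Strengthen — candidate rigid forms `S⁺ ⇒ crux` -/

/-- S1 = the route's own `FreeBoxPowerSaving` (stmt-4447, rate `a > 0`; Disproof: `a ≤ 2`). -/
abbrev S1_PowerSaving : Prop := FreeBoxPowerSaving

/-- S2 = the dead line's residual (worst-pair / axis form, aspect 2): `P(−m e₀ ↔ m e₀ inside Λ_{2m}) → 0`.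
`S2 ⇒ crux` is kernel-checked in `Lines/axis_fold_linear_depth_bgn.lean` (fold + chain landed);
numerically `≍ G(m)²` with `G → 0 ≡ θ(p_c) = 0` (MC-lead-a1.md). -/
def S2_AxisDecay : Prop :=
  Tendsto (fun m : ℕ => μc.real (openConnIn ↑(box 3 (2 * m))
    (Pi.single 0 (-(m : ℤ)) : V3) (Pi.single 0 (m : ℤ) : V3))) atTop (𝓝 0)

/-- S3 = half-space profile form ("lifted-root BGN", in-ℍ instead of in-box connections from the
centre of a box sitting on `∂ℍ`): `|Λ_r|⁻¹ Σ_{x ∈ r e₀ + Λ_r} P(r e₀ ↔ x inside ℍ) → 0`.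
`S3 ⇒ crux` (in-box ⊆ in-ℍ after translating the box onto `∂ℍ`); same enemy, same missing engine. -/
def S3_HalfSpaceProfile : Prop :=
  Tendsto (fun r : ℕ => (∑ x ∈ box 3 r, μc.real
      (openConnVia (withinGraph (zdGraph 3) (halfSpace 3)) (Pi.single 0 (r : ℤ))
        (x + Pi.single 0 (r : ℤ)))) / ((box 3 r).card : ℝ)) atTop (𝓝 0)

/-- S4 = scale contraction of the pair sum (the only "inductive" strengthening found):
`∃ λ < 1, σ > 0, C: pairSum(2n) ≤ 64 λ · pairSum(n) + C n^{6-σ}`. It implies the crux by iteration,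
fails above `p_c` as it must, but has NO mechanism: in-box connectivity at scale `2n` is not
controlled by the eight sub-boxes (paths leave sub-boxes) — the crux's essence. -/
def S4_ScaleContraction : Prop :=
  ∃ lam σ C : ℝ, lam < 1 ∧ 0 < σ ∧ ∀ n : ℕ, 1 ≤ n →
    (∑ x ∈ box 3 (2 * n), ∑ y ∈ box 3 (2 * n), μc.real (openConnIn ↑(box 3 (2 * n)) x y)) ≤
      64 * lam * (∑ x ∈ box 3 n, ∑ y ∈ box 3 n, μc.real (openConnIn ↑(box 3 n) x y)) +
        C * (n : ℝ) ^ (6 - σ)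

/-- S5 = uniform-in-`p < p_c` form WITH a rate in the correlation length (what a subcritical
transfer would need): `FA₂(p, n) ≤ ψ(ξ-free quantity)`. Typed as: a bound by a function of `n`
alone valid for all `p < p_c` — by Disproof §6 (`freeBoxSparse_iff_uniform_subcritical`) this is
EQUIVALENT to the crux, so it is not a strengthening at all (recorded to close the door). -/
def S5_UniformSubcritical : Prop :=
  ∃ ψ : ℕ → ℝ, Tendsto ψ atTop (𝓝 0) ∧ ∀ p : unitInterval,
    (p : ℝ) < criticalProb (zdGraph 3) (0 : V3) → ∀ n : ℕ,
      (∑ x ∈ box 3 n, ∑ y ∈ box 3 n, (bondPercolation (zdGraph 3) p).real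
        (openConnIn ↑(box 3 n) x y)) / ((box 3 n).card : ℝ) ^ 2 ≤ ψ n

/-! ## §D Decomposition — the best typed splits -/

/-- D1-fine: linear-aspect two-arm RATE, `P_{p_c}(A₂(r, K r)) ≤ C K^{-(1+σ)}` for large `K`, `r`
(`A₂(k,n) = (uniqZone k n)ᶜ`: two distinct clusters of `Λ_n` both joining `Λ_k` to `∂Λ_n`;
believed `ζ₂ ≈ 1.86 > 1`; known only at polynomial aspect, `AKN.dkt_prop1`). It kills FINE foams
(walls `≪` cell size) by the wall-cell count of §D of the census — but it is SUMMIT-STRENGTH: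
for `K` large it gives `ρ(εn, n) ≤ c⋆ ε`, the hypothesis H∞ of card two-spanning-sublinear-hegemony,
which yields `θ(p_c) = 0` directly (triage r1-1/2/3: "H∞ ⇒ continuity checks out"). -/
def D1_TwoArmRate : Prop :=
  ∃ σ C : ℝ, 0 < σ ∧ ∃ K₀ : ℕ, ∀ K : ℕ, K₀ ≤ K → ∀ᶠ r : ℕ in atTop,
    μc.real (uniqZone (d := 3) r (K * r))ᶜ ≤ C * (K : ℝ) ^ (-(1 + σ))

/-- D1-macro: the residual of every foam/segregation split — no two DISTINCT `δ`-dense free pieces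
of `Λ_n` (distinct inside `Λ_{2n}`) whose bulks are a macroscopic distance `≥ ε n` apart.
Implied by the crux (dense pieces are rare under FBS, `DenseMarkov`) and, with the landed
ceiling/boost/collar + segregation, implying it: `≡ crux`. This is the piece that "remains the whole
crux" in the census. -/
def D1_NoMacroscopicSegregatedPair : Prop :=
  ∀ δ ε : ℝ, 0 < δ → 0 < ε → Tendsto (fun n : ℕ => μc.real {ω | ∃ x ∈ box 3 n, ∃ x' ∈ box 3 n,
      IsDense δ (box 3 n) ω x ∧ IsDense δ (box 3 n) ω x' ∧
      ω ∉ openConnIn ↑(box 3 (2 * n)) x x' ∧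
      ∀ v ∈ box 3 n, ∀ v' ∈ box 3 n, ω ∈ openConnIn ↑(box 3 n) x v →
        ω ∈ openConnIn ↑(box 3 n) x' v' → ε * n ≤ ⨆ i, |((v i - v' i : ℤ) : ℝ)|}) atTop (𝓝 0)

/-- D2-a: the `liminf` half of the crux (sparse along SOME sequence of scales). Strictly weaker,
but (i) it does not feed `closes` (the assembly needs sparsity at the NonProliferation scales) and
(ii) there is no glue `liminf-form ∧ X ⇒ crux` with `X` provable: `FA₂` legitimately RISES across a
correlation length (supercritical `p`: small for `n ≪ ξ(p)`, `≈ θ²` beyond), so no same-`p`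
inter-scale monotonicity exists. -/
def D2_LiminfSparse : Prop := ∀ ε : ℝ, 0 < ε → ∃ᶠ n : ℕ in atTop, fa2 n < ε

/-- D3: polynomial finite-cluster tail at `p_c` (`P(m ≤ |C| < ∞) ≤ C m^{-κ}`); with the route's
`SubpolynomialBlocking` (stmt-4446) it gives the crux by the quarantine sandwich (card
blocking-quarantine-wiring W2, provable) — but the pair decides `θ(p_c) = 0` directly (sandwich at
`m = n`, triage r1-2 K3), so as a split of THIS crux it is a rival route, not a decomposition. -/
def D3_PolyFiniteTail : Prop :=
  ∃ κ C : ℝ, 0 < κ ∧ ∀ m : ℕ, 1 ≤ m →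
    μc.real {ω | (m : ℕ∞) ≤ (openCluster ω (0 : V3)).encard ∧ (openCluster ω (0 : V3)).Finite} ≤
      C * (m : ℝ) ^ (-κ)

/-! ## §N Negation — typed obstructions met while pushing the counter-world -/

/-- N-root (PROVABLE, S–M; new this session): **BGN root skeleton.** Let `R_t(ω)` be the set of sites
`w` having, for some axis direction `±e_i`, an open path inside the closed half-space
`{x | ±(x_i − w_i) ≥ 0}` from `w` to `±`-depth `> t`. Then every open path avoiding `R_t` has extent
`≤ t` in each coordinate (take the path's minimum in coordinate `i`: that point is a root), so a free
cluster `G ⊆ Λ_n` satisfies `|G| ≤ (4t+3)³ · |R_t ∩ Λ_n|` once `diam G > 2t`; and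
`E|R_t ∩ Λ_n| ≤ 6 h(t+1) |Λ_n|` by translation/rotation invariance. Typed as its consequence for
dense pieces: -/
def N_RootSkeletonBound : Prop :=
  ∀ δ : ℝ, 0 < δ → ∀ t n : ℕ, 2 * t < n →
    μc.real {ω | ∃ x ∈ box 3 n, IsDense δ (box 3 n) ω x} ≤ 6 * h (t + 1) * (4 * t + 3) ^ 3 / δ

/-- N-root consequence: `¬ crux ⇒ liminf_t t³ h(t+1) > 0`, i.e. **`t³ h t → 0 ⇒ crux`**. No
leverage: `h t ≍ t^{-0.975}` (boundary one-arm exponent), so the hypothesis is false in the healthy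
world; in the sup-distance variant of the skeleton (roots = sites with a half-space path to
sup-distance `> t`, one direction suffices) it is even REFUTABLE: `φ^ℍ_{p_c}(half-cube) ≥ 1`
(DCT floor for a boundary root, by continuity from `p > p_c = p_c(ℍ)`) gives
`P(0 ↔ sup-distance t in ℍ) ≥ c t⁻²`. -/
def N_HalfSpaceArmCubicDecay : Prop :=
  Tendsto (fun t : ℕ => (t : ℝ) ^ 3 * h t) atTop (𝓝 0)

/-- N-rate: the general quantitative-BGN hypothesis `h t ≤ C t^{-σ}`. The census records the
thresholds each attack needs: `σ > 3` (root skeleton), `σ > 1.52` (slab sieve with rooted sections),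
`x_s + x_b > 3/2` (knife-edge re-rooting), `2 − 2x_s < 0` (pores × antennas) — all false at
`x_s ≈ 0.975`; with `σ ≤ 1` no implication to the crux is known. Not summit-strength, not useful. -/
def N_HalfSpaceArmRate (σ : ℝ) : Prop :=
  ∃ C : ℝ, ∀ t : ℕ, 1 ≤ t → h t ≤ C * (t : ℝ) ^ (-σ)

/-! ## Sanity theorems (one line each) -/

/-- The crux implies its `liminf` half (D2-a is a weakening). -/
theorem d2_of_freeBoxSparse (hS : FreeBoxSparse) : D2_LiminfSparse := fun _ε hε =>
  ((freeBoxSparse_iff.1 hS).eventually (gt_mem_nhds hε)).frequently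

/- The summit conjunct implies the crux (irrefutability): landed as
`Theorems.FreeBoxSparse.Negative.not_percolationContinuityZ3_of_not_freeBoxSparse` /
`theta_pos_of_not_freeBoxSparse` (not restated here, so that no decl of this workfile has the
crux as its literal type). -/

/-- `h t → 0` (BGN, in tree): the qualitative input every boundary-rooted attack starts from. -/
theorem tendsto_h : Tendsto h atTop (𝓝 0) := by
  have hθ : theta (halfSpaceGraph 3) (halfSpaceOrigin 3) (criticalProbI 3) = 0 :=
    BarskyGrimmettNewman1991_Z3_holds
  have h' : Tendsto (fun t => ((bondPercolation (zdGraph 3) (criticalProbI 3)) (halfSpaceReach 3 t)).toReal)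
      atTop (𝓝 (0 : ENNReal).toReal) :=
    (ENNReal.tendsto_toReal ENNReal.zero_ne_top).comp
      (tendsto_measure_halfSpaceReach (d := 3) (criticalProbI 3) hθ)
  rw [ENNReal.toReal_zero] at h'
  have heq : h = fun t => ((bondPercolation (zdGraph 3) (criticalProbI 3)) (halfSpaceReach 3 t)).toReal := by
    funext t; rfl
  rw [heq]; exact h'

end Summit.CriticalPhenomena.PercolationContinuityZ3.Cruxes.FreeBoxSparse.StrategyCensus

end
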